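import Summits.QuantumFields.YangMills.Theses.LangevinControlUV
import Literature.MathematicalPhysics.QuantumLattice.TorusWilsonMarkov
import Literature.MathematicalPhysics.QuantumLattice.WilsonBlockHeatBathSemigroup
import Literature.MathematicalPhysics.QuantumLattice.WilsonBlockHeatBathLightCone2
import Summits.QuantumFields.YangMills.Theorems.LangevinControlUVLatticeGapInUVUnitsCBoxToDecay
import Summits.QuantumFields.YangMills.Theorems.LangevinControlUVLatticeGapInUVUnitsCBoxDecayToClustering
import Summits.QuantumFields.YangMills.Theorems.LangevinControlUVLatticeGapInUVUnitsCShellReduction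
import Summits.QuantumFields.YangMills.Theorems.LangevinControlUVLatticeGapInUVUnitsCBoxGaugeReduction
import Summits.QuantumFields.YangMills.Theorems.LangevinControlUVLatticeGapInUVUnitsCTVReduction
import Summits.QuantumFields.YangMills.Theorems.LangevinControlUVLatticeGapInUVUnitsCStubSeed
import Summits.QuantumFields.YangMills.Theorems.LangevinControlUVLatticeGapInUVUnitsCFSReduction

/-!
# Skeleton — crux `LatticeGapInUVUnitsC` (stmt-QuantumFields-16206), line `nested-shell-rho-mixing` (payload slug `Sketch`, ideator 2)

Line leads prover-line-stmt-QuantumFields-16206-c1-0 (v1–v3, 2026-08-16) and -c2-0 (v4, 2026-08-17).  Reshaped from ideator 2's first-lemma file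
`Cruxes/LatticeGapInUVUnitsC/Sketch_ideator2_r1.lean` (`condExp_sq_le_of_tower`, `pow_contraction`: HGR submultiplicativity
along a Markov triple) and the card `Ideas/nested-shell-rho-mixing.md` ("Next checkable statement": the one-sided shell
certificate + the composition `→ CruxRepaired`) into three registered, DEF-FREE stubs — the ONE-SIDED (closed box) variant of
the landed femto-slab pipeline (`stub_slabToDecay` p96985, `stub_decayToClustering` p97393, `reduction_concl_of_slab` p99152):

* geometry: BOXES of the torus `(ℤ/(2S+1))⁴` in the tree's cylinder convention (`condExp_wilsonMeasure_markov_slab`):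
  `box(x, w) = {ℓ | ∀ ν, (ℓ.1 ν − x ν).val < w}` (links based in the cube of side `w` with corner `x`), its enlargement by
  `R` layers `box(x − R, w + 2R)`, and the exterior σ-algebra at margin `M`, `ext_M(x, w) = cylinderEvents (box(x − (M−1),
  w + 2(M−1)))ᶜ` (links whose base point is `≥ M` away from the cube in SOME coordinate).  A box never wraps
  (`w + 2·margin ≤ 2S`); interior → exterior is separated by ONE closed shell (the card's one-sidedness).
* S1 `stub_boxMixing` — THE CERTIFICATE (open physics; the lead's stub): for compact simple `G`, faithful `r` and a CONTINUOUS
  unit map `a` carrying the femto two-point package, ONE box inequality `Var F ≤ K ∫ (F − μ[F | ext_D])²` for every bounded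
  measurable box observable `F`, on every torus `S ≥ S₁ β`, `β ≥ β₂`, at margin `D(β) = ⌈Θ/a β⌉`, `K` uniform in `β`, volume
  and box.  Equivalently (law of total variance) `‖μ[F | ext_D] − ∫F‖₂² ≤ (1 − 1/K) Var F`: the Hirschfeld–Gebelein–Rényi maximal
  correlation between a cube and the exterior of its `D`-enlargement is `≤ ρ = (1 − 1/K)^{1/2} < 1`, radius-uniformly — the
  card's `ShellRhoMixing`, in exterior form (by the Markov property `μ[F | ext]` reads only the separating shell).
* S2 `stub_boxToDecay` — box inequality at margin `D` ⇒ `∫ (μ[F | ext_{jD}] − ∫F)² ≤ (1 − 1/K)^j Var F` (Markov version of the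
  conditional expectation reading the one-layer enlargement, plaquette closure per coordinate, tower along nested exteriors;
  port of p96985; LANDED p124468).
* S3 `stub_boxDecayToClustering` — decay ⇒ `|corr_β(A, B, n)| ≤ C(A,B) e^{−(κ/D) n}` for `n ≤ S` (`A ∘ lift` reads the box of
  side `2M+1` cornered at `−M`, `τ_n B ∘ lift` lies outside its `jD`-enlargement through the TIME coordinate, pull-out +
  `2s|∫uv| ≤ ∫u² + s²∫v²`, a priori bound for small `n`; port of p97393; LANDED p124844).

STATUS v3 (lead cycle 1): S2 LANDED p124468, S3 LANDED p124844, the def-free transfer theorem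
`cruxC_of_boxStubs : S1 → S2 → S3 → LatticeGapInUVUnitsC` + `reduction_concl_of_box` LANDED p124983
(`Theorems/LangevinControlUVLatticeGapInUVUnitsCShellReduction.lean`); open: S1 `stub_boxMixing` only (the certificate).
CLOSING RECIPE: when S1 lands as a theorem `T1` with the registered signature (lead folder work/sig_S1.txt), the crux closes with
`theorem LatticeGapInUVUnitsC_holds : LatticeGapInUVUnitsC := cruxC_of_boxStubs T1 stub_boxToDecay stub_boxDecayToClustering`
(`--workitem stmt-QuantumFields-16206`).

STATUS v4 (lead c2, 2026-08-17): the open stub is RESHAPED to S1′ `stub_boxMixingInv` — S1 restricted to GAUGE-INVARIANT box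
observables (`IsGaugeInvariant F`), with the margin bound `2 ≤ ⌈Θ/a β⌉₊` supplied to its prover — and S1 `stub_boxMixing` is now a
THEOREM modulo S1′: `stub_boxMixing := stub_boxMixing_of_inv stub_boxMixingInv`, where the transfer `stub_boxMixing_of_inv`
(Elitzur box gauge reduction `BoxGaugeReduction.boxGaugeReduction` — orbit averaging over the gauge group at the sites touching
the box, which fix every exterior link once the margin is `≥ 2`; `a → 0` forces the margin `≥ 2` eventually) is LANDED/PROPOSED as
`Theorems/LangevinControlUVLatticeGapInUVUnitsCBoxGaugeReduction.lean` (p140137). Margin 1 would not do: a single boundary link is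
Haar-distributed (`Var = Var_Haar(Re tr ρ) > 0`) but pinned to `O(β^{-1/2})` by the exterior plaquette through it, so `K ≳ β/log β`.
ONE sorry = S1′. CLOSING RECIPE v4: a theorem `T1'` with S1′'s registered signature (lead folder gen/sig_stub_boxMixingInv.txt, 1971
chars) closes the crux by `LatticeGapInUVUnitsC_holds := cruxC_of_boxStubs (stub_boxMixing_of_inv T1') stub_boxToDecay
stub_boxDecayToClustering`.

STATUS v5 (lead c3, prover-line-stmt-QuantumFields-16206-c3-0, 2026-08-17): a SECOND, independent closing branch is registered next
to the nested-shell branch (which is unchanged: ONE sorry S1′): the Dobrushin–Shlosman / total-variation FINITE-SIZE branch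
(namespace `…Cruxes.LatticeGapInUVUnitsC.FiniteSize` at the end of this file).  S4 `stub_tvCertificate` (open; the certificate) —
for continuous package rulers the Wilson specification `ymSpecification r.ρ β` satisfies the TV finite-size condition of route
`OneCertifiedCube` (window `n`, threshold `ε`, `ε·M(n) < 1`) at the cell `⌈ℓ/a β⌉₊` of ONE physical length `ℓ`, for all `β ≥ β₂`:
clause for clause the condition of the EXISTING crux `OneCertifiedCube.CrossoverCertificate` (stmt-QuantumFields-16125) with the scheme
data `(sch.β k, sch.a k)` replaced by `(β, a β)`; S5 `stub_tvTransfer` (PROVABLE, bookkeeping over the tree's PROVED universal-threshold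
criterion `Theorems.FiniteSizeCriterion_proof`, item stmt-QuantumFields-8895) — certificate at `(ℓ, n, ε)` for `β ≥ β₂` + `a → 0` ⇒ the
crux's conclusion with `c₁ = κ(n,ε)/(2ℓ)`, `S₁ β = (8n+7)⌈ℓ/aβ⌉₊ — LANDED p141317 (`Theorems/LangevinControlUVLatticeGapInUVUnitsCTVReduction.lean`,
with the one-hypothesis form `latticeGapInUVUnitsC_of_tvFiniteSize : S4-text → LatticeGapInUVUnitsC`); composition `LatticeGapInUVUnitsC_of_tv`.
SORRIES v5: TWO, both certificates — S1′ `stub_boxMixingInv` and S4 `stub_tvCertificate`; EITHER closes the crux.  The crux therefore closes from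
EITHER certificate: S1′ (ρ-mixing, all tori/boxes) or S4 (ONE cube of `(4n+1)⁴` cells, all boundary conditions — the finite-size-criterion
form named in the item's informal text, shared with routes OneCertifiedCube / ConvexGribovBody / ParabolicTrajectory).

STATUS v6 (lead c4, prover-line-stmt-QuantumFields-16206-c4-0, 2026-08-17): a THIRD closing branch is registered (namespace
`…Cruxes.LatticeGapInUVUnitsC.AmplitudeCriterion` at the end of this file): the certificate stated a-FREE, as the finite-size
criterion the item's informal text names — S6 `stub_fsCertificate` (open; for every `u > 0`: top-of-box amplitude
`N⁸·Cov_{β,(ℤ/8N)⁴}(P₀, P_{N e₂}) ≥ u` at `β ≥ β₂`, `N ≥ 1` ⇒ clustering of all species pairs at rate `κ(u)/N` on all tori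
`S ≥ K(u)·N`, per-pair constants) and S7 `stub_fsTransfer` (provable bookkeeping: the LANDED seed `AmplitudeRatchet.stub_seed`
p122527 puts the amplitude `≥ umin` on the top femto octave for continuous package rulers; `a → 0` places `N(β) = ⌈ℓ₀/(16aβ)⌉₊`
there; rate `κ/N(β) ≥ (8κ/ℓ₀) a(β)`); composition `AmplitudeCriterion.LatticeGapInUVUnitsC_of_fs` concludes the crux BY NAME.
SORRIES v6: S1′, S4, S6 (three ALTERNATIVE certificates — any one closes the crux) and S7 (to be landed this cycle).

STATUS v7 (lead c4): S7 `stub_fsTransfer` LANDED p142636 (`Theorems/LangevinControlUVLatticeGapInUVUnitsCFSReduction.lean`, with the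
def-free one-hypothesis form `latticeGapInUVUnitsC_of_fsCertificate : S6-text → LatticeGapInUVUnitsC`) and imported here.  SORRIES v7: THREE,
all certificates — S1′ `stub_boxMixingInv`, S4 `stub_tvCertificate`, S6 `stub_fsCertificate`; ANY ONE closes the crux
(`NestedShell.LatticeGapInUVUnitsC_of` / `FiniteSize.LatticeGapInUVUnitsC_of_tv` / `AmplitudeCriterion.LatticeGapInUVUnitsC_of_fs`).
CLOSING RECIPE v7 (recommended item text = S6, `Cruxes/LatticeGapInUVUnitsC/CERTIFICATE-ITEM.md` v2): a theorem `T6` with S6's registered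
signature closes the crux by `LatticeGapInUVUnitsC_holds := …Theorems.LatticeGapInUVUnitsC.AmplitudeCriterion.latticeGapInUVUnitsC_of_fsCertificate T6`.

STATUS v8 (lead c5, prover-line-stmt-QuantumFields-16206-c5-0, 2026-08-17): no stub moved (none can: S1′, S4, S6 are three clothings of the
weak-coupling volume-uniform mass gap); S7 now refers to the LANDED `…Theorems.LatticeGapInUVUnitsC.AmplitudeCriterion.stub_fsTransfer`
(p142636; the v7 inline copy is deleted).  NEW, registered as a sub-goal and submitted `--supports` (p145507,
`Theorems/LangevinControlUVLatticeGapInUVUnitsCFedCertificate.lean`, sorry-free): the POINT-OF-USE STRENGTH CERTIFICATE of branch 3,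
`AmplitudeCriterion.latticeGapInUVUnitsC_iff_fedCertificate : LatticeGapInUVUnitsC ↔ FedS6`, where FedS6 is S6 fed the package of a
continuous unit map and given a free volume threshold `S₁(β)` instead of `K·N` (`⇐` = seed + transfer; `⇒` = the crux's rate `c₁ a β`
dominates `κ/N` at every certified scale: a certified amplitude `≥ u` inside the femto window has `u ≤ C Γ(N a β)` by the UPPER axis
clause at `L = 8N`, and `Γ < u/(|C|+1)` on `(0, s₀(u))` by the landed tightness `Γ(0⁺) = 0`, so `N a β ≥ min(s₀, ℓ₀/8)`).  Reading: the
registered a-free text S6 exceeds the crux by exactly the `K·N` threshold and a-free universality over `(G, r)`; fed and freed it IS the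
crux.  SORRIES v8: THREE (S1′, S4, S6), unchanged.

Composition: `LatticeGapInUVUnitsC_of` below applies the LANDED transfer theorem to S1 and the LANDED S2, S3, concluding the
crux BY NAME; its only sorry is S1′ (`stub_boxMixingInv`, since v4; S1 `stub_boxMixing` follows by the landed transfer).  Disproof honoured (tree `Cruxes/LatticeGapInUVUnitsC/Disproof.lean`, cycle 1): the package is FED to S1 (no
`(∀ a continuous, X) → crux` shape, cf. `not_forall_continuous_concl_of_xiUnbounded`); `Continuous a`, the lower bound's size and
`a → 0` are all available to S1; per-pair constants only (§5); no all-times / uniform-`C` variant is asserted.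
-/

open scoped BigOperators
open MeasureTheory Filter Topology
open Literature.MathematicalPhysics.QuantumFieldTheory Literature.MathematicalPhysics.QuantumLattice
open Summit.QuantumFields.YangMills.Theses.LangevinControlUV

noncomputable section

namespace Summit.QuantumFields.YangMills.Cruxes.LatticeGapInUVUnitsC.NestedShell

/-! ## The stubs (registered; S1 open physics, S2/S3 provable ports of the slab pipeline) -/

/-- **S1′ `stub_boxMixingInv` — the one-sided shell certificate on the GAUGE-INVARIANT algebra** (open; = the mass gap at
the physical scale `Θ` in maximal-correlation clothing; the skeleton's ONLY sorry since v4): for continuous package rulers, every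
bounded measurable GAUGE-INVARIANT box observable retains at most the fraction `1 − 1/K` of its variance after conditioning on
the links `≥ ⌈Θ/a β⌉` away from its box, uniformly in `β ≥ β₂`, the torus `S ≥ S₁ β` and the box; the prover may assume the
margin is `≥ 2` (supplied by the transfer from `a → 0`). -/
theorem stub_boxMixingInv : ∀ (G : Type) [Group G] [TopologicalSpace G] [IsTopologicalGroup G] [CompactSpace G], IsCompactSimpleLieGroup G → letI : MeasurableSpace G := borel G; haveI : BorelSpace G := ⟨rfl⟩; ∀ (r : LatticeRep G) (a : ℝ → ℝ), Continuous a → (∃ (Γ : ℝ → ℝ) (β₀ ℓ₀ c C : ℝ), 0 < ℓ₀ ∧ 0 < c ∧ (∀ β, 0 < a β) ∧ Filter.Tendsto a Filter.atTop (nhds 0) ∧ (∀ s : ℝ, 0 < s → s ≤ ℓ₀ → 0 < Γ s ∧ Γ s ≤ 1) ∧ ∀ (L : ℕ) [NeZero L] (β : ℝ), β₀ ≤ β → (L : ℝ) * a β ≤ ℓ₀ → let P : (Fin 4 → ZMod L) → Fin 4 → Fin 4 → GaugeConfig 4 L G → ℝ := fun x i j U => (r.N : ℝ) - (r.ρ (plaquetteHolonomy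 U x i j)).trace.re; let E : (GaugeConfig 4 L G → ℝ) → ℝ := fun F => wilsonExpectation (d := 4) (L := L) r.ρ β F; let cov : (GaugeConfig 4 L G → ℝ) → (GaugeConfig 4 L G → ℝ) → ℝ := fun F F' => E (fun U => F U * F' U) - E F * E F'; let dist : (Fin 4 → ZMod L) → (Fin 4 → ZMod L) → ℝ := fun x y => Real.sqrt (∑ k : Fin 4, (((x k - y k).valMinAbs : ℤ) : ℝ) ^ 2); (∀ n : ℕ, 1 ≤ n → 8 * n ≤ L → c * Γ ((n : ℝ) * a β) ≤ (n : ℝ) ^ 8 * cov (P 0 0 1) (P (Pi.single (2 : Fin 4) ((n : ℕ) : ZMod L)) 0 1) ∧ (n : ℝ) ^ 8 * cov (P 0 0 1) (P (Pi.single (2 : Fin 4) ((n : ℕ) : ZMod L)) 0 1) ≤ C * Γ ((n : ℝ) * a β)) ∧ (∀ (x y : Fin 4 → ZMod L) (i j i' j' : Fin 4), x ≠ y → i ≠ j → i' ≠ j' → |cov (P x i j) (P y i' j')| * dist x y ^ 8 ≤ C * Γ (dist x y * a β))) → ∃ (Θ K β₂ : ℝ) (S₁ : ℝ → ℕ), 0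 < Θ ∧ 1 ≤ K ∧ ∀ β : ℝ, β₂ ≤ β → 2 ≤ ⌈Θ / a β⌉₊ → ∀ S : ℕ, S₁ β ≤ S → ∀ (μ : Measure (GaugeConfig 4 (2 * S + 1) G)), μ = (wilsonMeasure r.ρ β : Measure (GaugeConfig 4 (2 * S + 1) G)) → ∀ (x : Fin 4 → ZMod (2 * S + 1)) (w : ℕ), w + 2 * ⌈Θ / a β⌉₊ ≤ 2 * S → ∀ F : GaugeConfig 4 (2 * S + 1) G → ℝ, Measurable F → (∃ M : ℝ, ∀ U, |F U| ≤ M) → IsGaugeInvariant F → DependsOn F {ℓ : Edge 4 (2 * S + 1) | ∀ ν, (ℓ.1 ν - x ν).val < w} → ∫ U, (F U - ∫ V, F V ∂μ) ^ 2 ∂μ ≤ K * ∫ U, (F U - (μ[F|cylinderEvents {ℓ : Edge 4 (2 * S + 1) | ∀ ν, (ℓ.1 ν - (x ν - ((⌈Θ / a β⌉₊ - 1 : ℕ) : ZMod (2 * S + 1)))).val < w + 2 * (⌈Θ / a β⌉₊ - 1)}ᶜ]) U) ^ 2 ∂μ := by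
  sorry

/-- **S1 `stub_boxMixing` — the one-sided shell certificate for ALL box observables**, now a theorem modulo S1′ (v4): the
landed/proposed transfer `stub_boxMixing_of_inv` (Elitzur box gauge reduction, p140137) applied to `stub_boxMixingInv`. -/
theorem stub_boxMixing : ∀ (G : Type) [Group G] [TopologicalSpace G] [IsTopologicalGroup G] [CompactSpace G], IsCompactSimpleLieGroup G → letI : MeasurableSpace G := borel G; haveI : BorelSpace G := ⟨rfl⟩; ∀ (r : LatticeRep G) (a : ℝ → ℝ), Continuous a → (∃ (Γ : ℝ → ℝ) (β₀ ℓ₀ c C : ℝ), 0 < ℓ₀ ∧ 0 < c ∧ (∀ β, 0 < a β) ∧ Filter.Tendsto a Filter.atTop (nhds 0) ∧ (∀ s : ℝ, 0 < s → s ≤ ℓ₀ → 0 < Γ s ∧ Γ s ≤ 1) ∧ ∀ (L : ℕ) [NeZero L] (β : ℝ), β₀ ≤ β → (L : ℝ) * a β ≤ ℓ₀ → let P : (Fin 4 → ZMod L) → Fin 4 → Fin 4 → GaugeConfig 4 L G → ℝ := fun x i j U => (r.N : ℝ) - (r.ρ (plaquetteHolonomy U x i j)).trace.re; let E : (GaugeConfig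 4 L G → ℝ) → ℝ := fun F => wilsonExpectation (d := 4) (L := L) r.ρ β F; let cov : (GaugeConfig 4 L G → ℝ) → (GaugeConfig 4 L G → ℝ) → ℝ := fun F F' => E (fun U => F U * F' U) - E F * E F'; let dist : (Fin 4 → ZMod L) → (Fin 4 → ZMod L) → ℝ := fun x y => Real.sqrt (∑ k : Fin 4, (((x k - y k).valMinAbs : ℤ) : ℝ) ^ 2); (∀ n : ℕ, 1 ≤ n → 8 * n ≤ L → c * Γ ((n : ℝ) * a β) ≤ (n : ℝ) ^ 8 * cov (P 0 0 1) (P (Pi.single (2 : Fin 4) ((n : ℕ) : ZMod L)) 0 1) ∧ (n : ℝ) ^ 8 * cov (P 0 0 1) (P (Pi.single (2 : Fin 4) ((n : ℕ) : ZMod L)) 0 1) ≤ C * Γ ((n : ℝ) * a β)) ∧ (∀ (x y : Fin 4 → ZMod L) (i j i' j' : Fin 4), x ≠ y → i ≠ j → i' ≠ j' → |cov (P x i j) (P y i' j')| * dist x y ^ 8 ≤ C * Γ (dist x y * a β))) → ∃ (Θ K β₂ : ℝ) (S₁ : ℝ → ℕ), 0 < Θ ∧ 1 ≤ K ∧ ∀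 β : ℝ, β₂ ≤ β → ∀ S : ℕ, S₁ β ≤ S → ∀ (μ : Measure (GaugeConfig 4 (2 * S + 1) G)), μ = (wilsonMeasure r.ρ β : Measure (GaugeConfig 4 (2 * S + 1) G)) → ∀ (x : Fin 4 → ZMod (2 * S + 1)) (w : ℕ), w + 2 * ⌈Θ / a β⌉₊ ≤ 2 * S → ∀ F : GaugeConfig 4 (2 * S + 1) G → ℝ, Measurable F → (∃ M : ℝ, ∀ U, |F U| ≤ M) → DependsOn F {ℓ : Edge 4 (2 * S + 1) | ∀ ν, (ℓ.1 ν - x ν).val < w} → ∫ U, (F U - ∫ V, F V ∂μ) ^ 2 ∂μ ≤ K * ∫ U, (F U - (μ[F|cylinderEvents {ℓ : Edge 4 (2 * S + 1) | ∀ ν, (ℓ.1 ν - (x ν - ((⌈Θ / a β⌉₊ - 1 : ℕ) : ZMod (2 * S + 1)))).val < w + 2 * (⌈Θ / a β⌉₊ - 1)}ᶜ]) U) ^ 2 ∂μ :=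
  Summit.QuantumFields.YangMills.Theorems.LatticeGapInUVUnitsC.NestedShell.stub_boxMixing_of_inv stub_boxMixingInv

/-! S2 `stub_boxToDecay` LANDED (p124468, `Theorems/LangevinControlUVLatticeGapInUVUnitsCBoxToDecay.lean`) and
S3 `stub_boxDecayToClustering` LANDED (p124844, `Theorems/LangevinControlUVLatticeGapInUVUnitsCBoxDecayToClustering.lean`),
both in namespace `Summit.QuantumFields.YangMills.Theorems.LatticeGapInUVUnitsC.NestedShell`, wave 1 of this lead; they are
imported and fed to the composition below, so the skeleton's ONLY sorry is S1′ (v4). -/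

/-! ## Composition (sorry-free; everything but S1 is a LANDED theorem) -/

/-- **The skeleton theorem** (v3/v4): `LatticeGapInUVUnitsC` BY NAME from S1 (since v4 a theorem modulo the only sorry S1′) through the landed transfer theorem
`cruxC_of_boxStubs` (p124983) fed with the landed S2 (p124468) and S3 (p124844). -/
theorem LatticeGapInUVUnitsC_of : LatticeGapInUVUnitsC :=
  Summit.QuantumFields.YangMills.Theorems.LatticeGapInUVUnitsC.NestedShell.cruxC_of_boxStubs stub_boxMixing
    Summit.QuantumFields.YangMills.Theorems.LatticeGapInUVUnitsC.NestedShell.stub_boxToDecay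
    Summit.QuantumFields.YangMills.Theorems.LatticeGapInUVUnitsC.NestedShell.stub_boxDecayToClustering

end Summit.QuantumFields.YangMills.Cruxes.LatticeGapInUVUnitsC.NestedShell

namespace Summit.QuantumFields.YangMills.Cruxes.LatticeGapInUVUnitsC.FiniteSize

/-! ## Second closing branch (v5): the total-variation finite-size certificate (Dobrushin–Shlosman) -/

/-- **S4 `stub_tvCertificate` — the TV finite-size certificate for package rulers** (open; = the crossover certificate of route
`OneCertifiedCube`, `CrossoverCertificate` stmt-QuantumFields-16125, re-parametrised by `(β, a β)` for a CONTINUOUS package ruler and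
fed the package): there are a physical length `ℓ > 0`, a window `n ≥ 1` and a threshold `ε ≥ 0` with `ε·((4n+3)⁴ − (4n+1)⁴) < 1` such that
for all `β ≥ β₂`, for every `[b,2b]`-frame `w` of `ℤ⁴` with `b = ⌈ℓ / a β⌉₊`, every cell-union `Y` inside the cube of `(4n+1)⁴` cells
containing the central cell, every pair of exterior data agreeing on the cube and every `[0,1]`-valued measurable cylinder function `f` of
the central cell, `|∫ f dγ_Y(·|η) − ∫ f dγ_Y(·|η′)| ≤ ε` for the Wilson specification `γ = ymSpecification r.ρ β`. -/
theorem stub_tvCertificate : ∀ (G : Type) [Group G] [TopologicalSpace G] [IsTopologicalGroup G] [CompactSpace G], IsCompactSimpleLieGroup G → letI : MeasurableSpace G := borel G; haveI : BorelSpace G := ⟨rfl⟩; ∀ (r : LatticeRep G) (a : ℝ → ℝ), Continuous a → (∃ (Γ : ℝ → ℝ) (β₀ ℓ₀ c C : ℝ), 0 < ℓ₀ ∧ 0 < c ∧ (∀ β, 0 < a β) ∧ Filter.Tendsto a Filter.atTop (nhds 0) ∧ (∀ s : ℝ, 0 < s → s ≤ ℓ₀ → 0 < Γ s ∧ Γ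 s ≤ 1) ∧ ∀ (L : ℕ) [NeZero L] (β : ℝ), β₀ ≤ β → (L : ℝ) * a β ≤ ℓ₀ → let P : (Fin 4 → ZMod L) → Fin 4 → Fin 4 → GaugeConfig 4 L G → ℝ := fun x i j U => (r.N : ℝ) - (r.ρ (plaquetteHolonomy U x i j)).trace.re; let E : (GaugeConfig 4 L G → ℝ) → ℝ := fun F => wilsonExpectation (d := 4) (L := L) r.ρ β F; let cov : (GaugeConfig 4 L G → ℝ) → (GaugeConfig 4 L G → ℝ) → ℝ := fun F F' => E (fun U => F U * F' U) - E F * E F'; let dist : (Fin 4 → ZMod L) → (Fin 4 → ZMod L) → ℝ := fun x y => Real.sqrt (∑ k : Fin 4, (((x k - y k).valMinAbs : ℤ) : ℝ) ^ 2); (∀ n : ℕ, 1 ≤ n → 8 * n ≤ L → c * Γ ((n : ℝ) * a β) ≤ (n : ℝ) ^ 8 * cov (P 0 0 1) (P (Pi.single (2 : Fin 4) ((n : ℕ) : ZMod L)) 0 1) ∧ (n : ℝ) ^ 8 * cov (P 0 0 1) (P (Pi.single (2 : Fin 4) ((n : ℕ) : ZMod L)) 0 1) ≤ C * Γ ((n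 : ℝ) * a β)) ∧ (∀ (x y : Fin 4 → ZMod L) (i j i' j' : Fin 4), x ≠ y → i ≠ j → i' ≠ j' → |cov (P x i j) (P y i' j')| * dist x y ^ 8 ≤ C * Γ (dist x y * a β))) → ∃ ℓ : ℝ, 0 < ℓ ∧ ∃ (n : ℕ) (ε : ℝ), 1 ≤ n ∧ 0 ≤ ε ∧ ε * ((((4 * n + 3) ^ 4 - (4 * n + 1) ^ 4 : ℕ)) : ℝ) < 1 ∧ ∃ β₂ : ℝ, ∀ β : ℝ, β₂ ≤ β → (∀ w : Fin 4 → ℤ → ℤ, (∀ i j, w i j + ((⌈ℓ / a β⌉₊ : ℕ) : ℤ) ≤ w i (j + 1) ∧ w i (j + 1) ≤ w i j + 2 * ((⌈ℓ / a β⌉₊ : ℕ) : ℤ)) → ∀ Y : Finset (Fin 4 → ℤ), Y ⊆ (Fintype.piFinset fun _ : Fin 4 => Finset.Icc (-(2 * ((n : ℕ) : ℤ))) (2 * ((n : ℕ) : ℤ))) → (0 : Fin 4 → ℤ) ∈ Y → ∀ η η' : LGConfig 4 G, (∀ e ∈ (Fintype.piFinset fun _ : Fin 4 => Finset.Icc (-(2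 * ((n : ℕ) : ℤ))) (2 * ((n : ℕ) : ℤ))).biUnion (fun y : Fin 4 → ℤ => (Fintype.piFinset fun i : Fin 4 => Finset.Ico (w i (y i)) (w i (y i + 1))) ×ˢ (Finset.univ : Finset (Fin 4))), η e = η' e) → ∀ f : LGConfig 4 G → ℝ, IsCylinder f ((fun y : Fin 4 → ℤ => (Fintype.piFinset fun i : Fin 4 => Finset.Ico (w i (y i)) (w i (y i + 1))) ×ˢ (Finset.univ : Finset (Fin 4))) 0) → Measurable f → (∀ U, 0 ≤ f U ∧ f U ≤ 1) → |(∫ U, f U ∂(ymSpecification r.ρ β (Y.biUnion (fun y : Fin 4 → ℤ => (Fintype.piFinset fun i : Fin 4 => Finset.Ico (w i (y i)) (w i (y i + 1))) ×ˢ (Finset.univ : Finset (Fin 4)))) η)) - ∫ U, f U ∂(ymSpecification r.ρ β (Y.biUnion (fun y : Fin 4 → ℤ => (Fintype.piFinset fun i : Fin 4 => Finset.Ico (w i (y i)) (w i (y i + 1))) ×ˢ (Finset.univ : Finset (Fin 4)))) η')| ≤ ε) := by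
  sorry

/-- **S5 `stub_tvTransfer` — certificate + `a → 0` ⇒ clustering in the units of `a`** (LANDED p141317
`Theorems/LangevinControlUVLatticeGapInUVUnitsCTVReduction.lean`; bookkeeping over the tree's proved
universal-threshold criterion `Summit.QuantumFields.YangMills.Theorems.FiniteSizeCriterion_proof`, stmt-QuantumFields-8895: the condition
at cell `b` gives `C(A,B) e^{−κ t/b}` on all tori `2S+1 ≥ (8n+7)b`, and `⌈ℓ/aβ⌉₊ aβ ≤ 2ℓ` once `aβ ≤ ℓ`, so `c₁ = κ/(2ℓ)`,
`S₁ β = (8n+7)⌈ℓ/aβ⌉₊`). -/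
theorem stub_tvTransfer : ∀ (G : Type) [Group G] [TopologicalSpace G] [IsTopologicalGroup G] [CompactSpace G] [MeasurableSpace G] [BorelSpace G] (r : LatticeRep G) (a : ℝ → ℝ) (ℓ : ℝ) (n : ℕ) (ε β₂ : ℝ), (∀ β, 0 < a β) → Filter.Tendsto a Filter.atTop (nhds 0) → 0 < ℓ → 1 ≤ n → 0 ≤ ε → ε * ((((4 * n + 3) ^ 4 - (4 * n + 1) ^ 4 : ℕ)) : ℝ) < 1 → (∀ β : ℝ, β₂ ≤ β → (∀ w : Fin 4 → ℤ → ℤ, (∀ i j, w i j + ((⌈ℓ / a β⌉₊ : ℕ) : ℤ) ≤ w i (j + 1) ∧ w i (j + 1) ≤ w i j + 2 * ((⌈ℓ / a β⌉₊ : ℕ) : ℤ)) → ∀ Y : Finset (Fin 4 → ℤ), Y ⊆ (Fintype.piFinset fun _ : Fin 4 => Finset.Icc (-(2 * ((n : ℕ) : ℤ))) (2 * ((n : ℕ) : ℤ))) → (0 : Fin 4 → ℤ) ∈ Y → ∀ η η' : LGConfig 4 G, (∀ e ∈ (Fintype.piFinset fun _ : Fin 4 => Finset.Icc (-(2 * ((n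 : ℕ) : ℤ))) (2 * ((n : ℕ) : ℤ))).biUnion (fun y : Fin 4 → ℤ => (Fintype.piFinset fun i : Fin 4 => Finset.Ico (w i (y i)) (w i (y i + 1))) ×ˢ (Finset.univ : Finset (Fin 4))), η e = η' e) → ∀ f : LGConfig 4 G → ℝ, IsCylinder f ((fun y : Fin 4 → ℤ => (Fintype.piFinset fun i : Fin 4 => Finset.Ico (w i (y i)) (w i (y i + 1))) ×ˢ (Finset.univ : Finset (Fin 4))) 0) → Measurable f → (∀ U, 0 ≤ f U ∧ f U ≤ 1) → |(∫ U, f U ∂(ymSpecification r.ρ β (Y.biUnion (fun y : Fin 4 → ℤ => (Fintype.piFinset fun i : Fin 4 => Finset.Ico (w i (y i)) (w i (y i + 1))) ×ˢ (Finset.univ : Finset (Fin 4)))) η)) - ∫ U, f U ∂(ymSpecification r.ρ β (Y.biUnion (fun y : Fin 4 → ℤ => (Fintype.piFinset fun i : Fin 4 => Finset.Ico (w i (y i)) (w i (y i + 1))) ×ˢ (Finset.univ : Finset (Fin 4)))) η')| ≤ ε)) → ∃ (c₁ β₂ : ℝ) (S₁ : ℝ → ℕ), 0 < c₁ ∧ ∀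 A B : YMSpecies G, ∃ C : ℝ, ∀ β : ℝ, β₂ ≤ β → ∀ S t : ℕ, S₁ β ≤ S → t ≤ S → |latticeConnectedCorr r.ρ β (2 * S + 1) A.F B.F t| ≤ C * Real.exp (-(c₁ * a β * t)) :=
  Summit.QuantumFields.YangMills.Theorems.LatticeGapInUVUnitsC.FiniteSize.stub_tvTransfer

/-- **The skeleton's second concluding theorem** (v5): `LatticeGapInUVUnitsC` BY NAME from S4 through S5. -/
theorem LatticeGapInUVUnitsC_of_tv : LatticeGapInUVUnitsC := by
  intro G _ _ _ _ hG
  letI : MeasurableSpace G := borel G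
  haveI : BorelSpace G := ⟨rfl⟩
  intro r a ha hP
  obtain ⟨ℓ, hℓ, n, ε, hn, hε, hM, β₂, hFS⟩ := stub_tvCertificate G hG r a ha hP
  obtain ⟨Γ, β₀, ℓ₀, c, C, -, -, hpos, hlim, -, -⟩ := hP
  exact stub_tvTransfer G r a ℓ n ε β₂ hpos hlim hℓ hn hε hM hFS

end Summit.QuantumFields.YangMills.Cruxes.LatticeGapInUVUnitsC.FiniteSize


namespace Summit.QuantumFields.YangMills.Cruxes.LatticeGapInUVUnitsC.AmplitudeCriterion

/-! ## Third closing branch (v6, lead c4): the a-FREE finite-size certificate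

The crux's informal text calls the item "the FINITE-SIZE-CRITERION form of the Millennium gap — 'amplitude ≥ u_min at lattice
scale n(β) ⇒ clustering at rate ≥ c₁′/n(β)' — an a-free implication".  This branch registers exactly that implication as the
certificate, with NO unit map `a`, NO shape `Γ`, NO continuity in its statement: S6 `stub_fsCertificate` — for compact simple `G`,
faithful `r` and every threshold `u > 0` there are `κ > 0`, `β₂`, `K` and per-pair constants `C(A,B)` such that whenever the
dimensionless top-of-box curvature amplitude `N⁸ · Cov_{β,(ℤ/8N)⁴}(P_0^{01}, P_{N e₂}^{01})` at coupling `β ≥ β₂` and scale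
`N ≥ 1` is `≥ u`, every pair of gauge-invariant local observables clusters at rate `κ/N` on every torus of side `2S+1`,
`S ≥ K·N`, `t ≤ S` (dimensional transmutation: the mass gap is comparable to the scale at which the running amplitude
reaches `u`).  It is fed by the LANDED seed `AmplitudeRatchet.stub_seed` (p122527, ratchet line S1: for a CONTINUOUS unit map
carrying the package, the amplitude is `≥ umin > 0` on the whole top femto octave `ℓ₀/16 ≤ N a(β) ≤ ℓ₀/8`, `β ≥ β₀` — the one
place where `Continuous a` and the SIZE of the lower bound do infrared work) through the bookkeeping transfer S7
`stub_fsTransfer` (`a → 0` puts `N(β) = ⌈ℓ₀/(16 a β)⌉₊` in the octave; rate `κ/N(β) ≥ (8κ/ℓ₀)·a(β)`; `S₁ β = K·N(β)`).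
All three load-bearing hypotheses of the standing Disproof (§2) are consumed: continuity + lower-bound size by the seed,
`a → 0` by the transfer; the certificate is quantified per `(β, N)` actually certified, never over "all continuous rulers".
S6 is the weakest member of the certificate family registered on this crux (S1′ box ρ-mixing, S4 TV finite-size,
ratchet `stub_ratioDichotomy`, femtoSlab, BlockSampler all carry the package and the ruler); it is false verbatim for
`U(1)` (Coulomb phase: the free-photon amplitude is scale-invariant, clustering polynomial) and for finite `G` — both
excluded by `IsCompactSimpleLieGroup` — and it is the statement a finite-size-scaling proof of the lattice mass gap would
deliver.  SORRIES v6: S1′, S4, S6 (alternative certificates — ANY ONE closes the crux) and S7 (provable; LANDED p142636 in v7). -/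

/-- **S6 `stub_fsCertificate` — the a-free finite-size certificate** (open; the mass gap in finite-size-scaling clothing):
for compact simple `G`, faithful `r` and every `u > 0` there are `κ > 0`, `β₂`, `K : ℕ` and, for every pair of species
`A, B`, a constant `C` such that for all `β ≥ β₂` and `N ≥ 1`: if the top-of-box amplitude
`N⁸ · Cov_{β,(ℤ/8N)⁴}(P_0^{01}, P_{N e₂}^{01})` is `≥ u`, then `|corr_β^{(2S+1)}(A, B; t)| ≤ C e^{−κ t/N}` for all
`S ≥ K N`, `t ≤ S`. -/
theorem stub_fsCertificate : ∀ (G : Type) [Group G] [TopologicalSpace G] [IsTopologicalGroup G] [CompactSpace G] [MeasurableSpace G] [BorelSpace G], IsCompactSimpleLieGroup G → ∀ (r : LatticeRep G) (u : ℝ), 0 < u → ∃ (κ β₂ : ℝ) (K : ℕ), 0 < κ ∧ ∀ A B : YMSpecies G, ∃ C : ℝ, ∀ β : ℝ, β₂ ≤ β → ∀ (N : ℕ) [NeZero (8 * N)], 1 ≤ N → u ≤ ((N : ℕ) : ℝ) ^ 8 * (wilsonExpectation r.ρ β (fun U : GaugeConfig 4 (8 * N) G => ((r.N : ℝ) - (r.ρ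 (plaquetteHolonomy U 0 0 1)).trace.re) * ((r.N : ℝ) - (r.ρ (plaquetteHolonomy U (Pi.single (2 : Fin 4) ((N : ℕ) : ZMod (8 * N))) 0 1)).trace.re)) - wilsonExpectation r.ρ β (fun U : GaugeConfig 4 (8 * N) G => (r.N : ℝ) - (r.ρ (plaquetteHolonomy U 0 0 1)).trace.re) * wilsonExpectation r.ρ β (fun U : GaugeConfig 4 (8 * N) G => (r.N : ℝ) - (r.ρ (plaquetteHolonomy U (Pi.single (2 : Fin 4) ((N : ℕ) : ZMod (8 * N))) 0 1)).trace.re)) → ∀ S t : ℕ, K * N ≤ S → t ≤ S → |latticeConnectedCorr r.ρ β (2 * S + 1) A.F B.F t| ≤ C * Real.exp (-(κ * t / N)) := by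
  sorry

-- (v8) the v7 inline copy `concl_of_fsCertificate_inline` of the landed pipeline lemma is deleted; S7 below is the landed theorem.


/-- **S7 `stub_fsTransfer` — seed + a-free certificate + `a → 0` ⇒ the crux's conclusion** (LANDED p142636
`Theorems/LangevinControlUVLatticeGapInUVUnitsCFSReduction.lean`; bookkeeping): with
`N(β) = ⌈ℓ₀ / (16 a β)⌉₊`, once `a β < ℓ₀/16` the pair `(β, N(β))` lies in the seed's octave `ℓ₀ ≤ 16 N a β`,
`8 N a β ≤ ℓ₀`, so the amplitude there is `≥ umin` and the certificate fires; `κ t / N(β) ≥ (8κ/ℓ₀) a(β) t` by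
`8 N(β) a(β) ≤ ℓ₀`; take `c₁ = 8κ/ℓ₀`, `β₃ = max β₀ β₂ β₄`, `S₁ β = K N(β)`, constants `max C 0`. -/
theorem stub_fsTransfer : ∀ (G : Type) [Group G] [TopologicalSpace G] [IsTopologicalGroup G] [CompactSpace G] [MeasurableSpace G] [BorelSpace G] (r : LatticeRep G) (a : ℝ → ℝ) (β₀ ℓ₀ umin κ β₂ : ℝ) (K : ℕ), (∀ β, 0 < a β) → Filter.Tendsto a Filter.atTop (nhds 0) → 0 < ℓ₀ → 0 < κ → (∀ β : ℝ, β₀ ≤ β → ∀ (N : ℕ) [NeZero (8 * N)], ℓ₀ ≤ 16 * ((N : ℝ) * a β) → 8 * ((N : ℝ) * a β) ≤ ℓ₀ → umin ≤ ((N : ℕ) : ℝ) ^ 8 * (wilsonExpectation r.ρ β (fun U : GaugeConfig 4 (8 * N) G => ((r.N : ℝ) - (r.ρ (plaquetteHolonomy U 0 0 1)).trace.re) * ((r.N : ℝ) - (r.ρ (plaquetteHolonomy U (Pi.single (2 : Fin 4) ((N : ℕ) : ZMod (8 * N))) 0 1)).trace.re)) - wilsonExpectation r.ρ β (fun U : GaugeConfig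 4 (8 * N) G => (r.N : ℝ) - (r.ρ (plaquetteHolonomy U 0 0 1)).trace.re) * wilsonExpectation r.ρ β (fun U : GaugeConfig 4 (8 * N) G => (r.N : ℝ) - (r.ρ (plaquetteHolonomy U (Pi.single (2 : Fin 4) ((N : ℕ) : ZMod (8 * N))) 0 1)).trace.re))) → (∀ A B : YMSpecies G, ∃ C : ℝ, ∀ β : ℝ, β₂ ≤ β → ∀ (N : ℕ) [NeZero (8 * N)], 1 ≤ N → umin ≤ ((N : ℕ) : ℝ) ^ 8 * (wilsonExpectation r.ρ β (fun U : GaugeConfig 4 (8 * N) G => ((r.N : ℝ) - (r.ρ (plaquetteHolonomy U 0 0 1)).trace.re) * ((r.N : ℝ) - (r.ρ (plaquetteHolonomy U (Pi.single (2 : Fin 4) ((N : ℕ) : ZMod (8 * N))) 0 1)).trace.re)) - wilsonExpectation r.ρ β (fun U : GaugeConfig 4 (8 * N) G => (r.N : ℝ) - (r.ρ (plaquetteHolonomy U 0 0 1)).trace.re) * wilsonExpectation r.ρ β (fun U : GaugeConfig 4 (8 * N) G => (r.N : ℝ) - (r.ρ (plaquetteHolonomy U (Pi.single (2 : Fin 4)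 ((N : ℕ) : ZMod (8 * N))) 0 1)).trace.re)) → ∀ S t : ℕ, K * N ≤ S → t ≤ S → |latticeConnectedCorr r.ρ β (2 * S + 1) A.F B.F t| ≤ C * Real.exp (-(κ * t / N))) → ∃ (c₁ β₃ : ℝ) (S₁ : ℝ → ℕ), 0 < c₁ ∧ ∀ A B : YMSpecies G, ∃ C : ℝ, ∀ β : ℝ, β₃ ≤ β → ∀ S t : ℕ, S₁ β ≤ S → t ≤ S → |latticeConnectedCorr r.ρ β (2 * S + 1) A.F B.F t| ≤ C * Real.exp (-(c₁ * a β * t)) :=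
  Summit.QuantumFields.YangMills.Theorems.LatticeGapInUVUnitsC.AmplitudeCriterion.stub_fsTransfer

/-- **The skeleton's third concluding theorem** (v6): `LatticeGapInUVUnitsC` BY NAME from the landed seed
`AmplitudeRatchet.stub_seed` (p122527), the a-free certificate S6 and the transfer S7. -/
theorem LatticeGapInUVUnitsC_of_fs : LatticeGapInUVUnitsC := by
  intro G _ _ _ _ hG
  letI : MeasurableSpace G := borel G
  haveI : BorelSpace G := ⟨rfl⟩
  intro r a ha hP
  obtain ⟨Γ, β₀, ℓ₀, c, C, hℓ₀, hc, hpos, hlim, hΓ, hbox⟩ := hP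
  obtain ⟨umin, humin, hseed⟩ :=
    Summit.QuantumFields.YangMills.Theorems.LatticeGapInUVUnitsC.AmplitudeRatchet.stub_seed G r a Γ β₀ ℓ₀ c C ha hℓ₀ hc
      hpos hlim hΓ hbox
  obtain ⟨κ, β₂, K, hκ, hcert⟩ := stub_fsCertificate G hG r umin humin
  exact stub_fsTransfer G r a β₀ ℓ₀ umin κ β₂ K hpos hlim hℓ₀ hκ hseed hcert

end Summit.QuantumFields.YangMills.Cruxes.LatticeGapInUVUnitsC.AmplitudeCriterion

end
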